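import Summits.KontsevichZagierPeriods.KontsevichZagierPeriods.Theorems.LinRedNormalFormArrangementNormalFormStubSeparateZeroGoodPieces

/-!
# Stub `stub_separateZero` (crux `ArrangementNormalForm`, line `janus-bands`) — part `FibreMass`

BAD PIECES ARE NULL (divergence lemma along the bad coordinate) and the FIBRE-MASS THEOREM
(`integrableOn_LB`): for a bounded Janus band datum of base dimension one, if `P(y)·(letter block)`
is absolutely integrable for a nonzero real polynomial `P`, then so is the letter block (cover the
domain by the pieces up to a null set; good pieces converge; a bad piece meets `{|P| ≥ δ}` in a
null set for every `δ`, hence is null).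
-/

noncomputable section

open Set MeasureTheory
open Literature.NumberTheory.Transcendental
open scoped ENNReal

namespace Summit.KontsevichZagierPeriods.ArrangementNormalForm.JanusBands

namespace SepZero

variable {k : ℕ} {S : Finset Atom} {Yb : Set ℝ} {lo hi : Fin k → Fin k ⊕ Atom}

/-! ### Bad pieces are null -/

/-- On a piece, a lettered factor is bounded below. -/
theorem letter_factor_ge {π : Piece k S} {z : Fin (1 + k) → ℝ} {D : Set (Fin (1 + k) → ℝ)}
    (hz : z ∈ pset D S π) {L : ℝ} (hzL : ∀ j, |z j| ≤ L) (i : Fin k) {c : Atom} (hc : c ∈ S) :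
    (|L| + Lat S L + 1)⁻¹ ≤ |1 / (z (fc i) - av c (z (bo k)))| := by
  have hyL : |z (bo k)| ≤ L := hzL _
  have h1 : |z (fc i) - av c (z (bo k))| ≤ |L| + Lat S L + 1 := by
    refine (abs_sub _ _).trans ?_
    linarith [(hzL (fc i)).trans (le_abs_self L), abs_av_le hc hyL]
  have hne : z (fc i) - av c (z (bo k)) ≠ 0 := by
    have hb := hz.2.1 i
    rcases atom_outside hz i hc with h | h
    · exact sub_ne_zero.2 (show z (fc i) ≠ av c (z (bo k)) by linarith [hb.1])
    · exact sub_ne_zero.2 (show z (fc i) ≠ av c (z (bo k)) by linarith [hb.2])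
  rw [one_div, abs_inv]
  exact inv_anti₀ (abs_pos.2 hne) h1

/-- `Lat` is nonnegative. -/
theorem Lat_nonneg (S : Finset Atom) (L : ℝ) : 0 ≤ Lat S L :=
  Finset.sum_nonneg fun c _ => by positivity

/-- **A bad piece on which the letter block is integrable is null** (divergence lemma along the
bad coordinate, whose sections reach down/up to the bad letter). -/
theorem volume_pset_inter_eq_zero (hYb : MeasurableSet Yb)
    (hlo : ∀ i c, lo i = Sum.inr c → c ∈ S) (hhi : ∀ i c, hi i = Sum.inr c → c ∈ S)
    (a : Fin k → Option Atom) (ha : ∀ i c, a i = some c → c ∈ S) {L : ℝ}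
    (hL : ∀ z ∈ dom Yb lo hi, ∀ j, |z j| ≤ L) (π : Piece k S) (hbad : ¬ Good a π)
    {K : Set ℝ} (hK : MeasurableSet K)
    (hint : IntegrableOn (LB a) (pset (dom Yb lo hi) S π ∩ {z | z (bo k) ∈ K})) :
    volume (pset (dom Yb lo hi) S π ∩ {z | z (bo k) ∈ K}) = 0 := by
  classical
  have hbad' : ∃ i c, a i = some c ∧ ((π.β i = i ∧ c = π.V i) ∨ (π.τ i = i ∧ c = π.W i)) := by
    by_contra h
    push Not at h
    exact hbad fun i c hic => ⟨fun hb hc => (h i c hic).1 hb hc, fun ht hc => (h i c hic).2 ht hc⟩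
  obtain ⟨i, c, hic, hbad⟩ := hbad'
  set S' := pset (dom Yb lo hi) S π ∩ {z | z (bo k) ∈ K} with hS'
  have hS'm : MeasurableSet S' := (measurableSet_pset (measurableSet_dom hYb lo hi) π).inter
    (hK.preimage (measurable_pi_apply _))
  set M : ℝ := |L| + Lat S L + 1 with hM
  have hM1 : 1 ≤ M := by rw [hM]; linarith [abs_nonneg L, Lat_nonneg S L]
  have hM0 : 0 < M := by linarith
  -- lower bound for the letter block along the bad coordinate
  have hlow : ∀ z ∈ S', (M⁻¹) ^ k * |z (fc i) - av c (z (bo k))|⁻¹ ≤ |LB a z| := by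
    intro z hz
    have hzL := hL z hz.1.1
    rw [LB, Finset.abs_prod, ← Finset.mul_prod_erase _ _ (Finset.mem_univ i), hic]
    simp only [Option.elim, one_div, abs_inv]
    rw [mul_comm]
    refine mul_le_mul_of_nonneg_left ?_ (by positivity)
    calc (M⁻¹) ^ k ≤ (M⁻¹) ^ (Finset.univ.erase i).card := by
          refine pow_le_pow_of_le_one (by positivity) (inv_le_one_of_one_le₀ hM1) ?_
          exact (Finset.card_le_univ _).trans (by rw [Fintype.card_fin])
      _ = ∏ _m ∈ Finset.univ.erase i, M⁻¹ := (Finset.prod_const _).symm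
      _ ≤ ∏ m ∈ Finset.univ.erase i, |(a m).elim 1 (fun c => (z (fc m) - av c (z (bo k)))⁻¹)| := by
          refine Finset.prod_le_prod (fun _ _ => by positivity) fun m _ => ?_
          cases ham : a m with
          | none => simpa using inv_le_one_of_one_le₀ hM1
          | some c' =>
            simp only [Option.elim]
            have := letter_factor_ge hz.1 hzL m (ha m c' ham)
            rwa [one_div] at this
  rcases hbad with ⟨hβ, rfl⟩ | ⟨hτ, rfl⟩
  · refine volume_eq_zero_of_integrableOn S' hS'm (fc i) (bo k) (fc_ne_bo i) (av (π.V i))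
      (measurable_av _) (fun z hz x hx => ?_) (by positivity) hlow hint
    have hlt : av (π.V i) (z (bo k)) < z (fc i) := (hz.1.2.1 i).1
    rw [Set.uIoo_of_le hlt.le] at hx
    refine ⟨update_mem_pset_bot hlo hhi hz.1 hβ hx.1 hx.2, ?_⟩
    show Function.update z (fc i) x (bo k) ∈ K
    rw [Function.update_of_ne (fc_ne_bo i).symm]; exact hz.2
  · refine volume_eq_zero_of_integrableOn S' hS'm (fc i) (bo k) (fc_ne_bo i) (av (π.W i))
      (measurable_av _) (fun z hz x hx => ?_) (by positivity) hlow hint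
    have hlt : z (fc i) < av (π.W i) (z (bo k)) := (hz.1.2.1 i).2
    rw [Set.uIoo_of_ge hlt.le] at hx
    refine ⟨update_mem_pset_top hlo hhi hz.1 hτ hx.1 hx.2, ?_⟩
    show Function.update z (fc i) x (bo k) ∈ K
    rw [Function.update_of_ne (fc_ne_bo i).symm]; exact hz.2

/-! ### The exceptional set of the covering -/

/-- Non-generic points: two equal fibre coordinates, or a fibre coordinate equal to an atom. -/
def exc (k : ℕ) (S : Finset Atom) : Set (Fin (1 + k) → ℝ) :=
  {z | (∃ i j, i ≠ j ∧ z (fc i) = z (fc j)) ∨ ∃ i, ∃ q ∈ S, z (fc i) = av q (z (bo k))}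

/-- The exceptional set is null. -/
theorem volume_exc (k : ℕ) (S : Finset Atom) : volume (exc k S) = 0 := by
  have h1 : ∀ i j : Fin k, i ≠ j → volume {z : Fin (1 + k) → ℝ | z (fc i) = z (fc j)} = 0 :=
    fun i j hij => volume_graph_eq_zero (fc i) (fun z => z (fc j)) (measurable_pi_apply _)
      fun z x => Function.update_of_ne (fun h => hij (fc_injective h).symm) _ _
  have h2 : ∀ (i : Fin k) (q : Atom), volume {z : Fin (1 + k) → ℝ | z (fc i) = av q (z (bo k))} = 0 :=
    fun i q => volume_graph_eq_zero (fc i) (fun z => av q (z (bo k)))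
      ((measurable_av q).comp (measurable_pi_apply _))
      fun z x => by simp [Function.update_of_ne (fc_ne_bo i).symm]
  have hsub : exc k S ⊆ (⋃ i, ⋃ j, {z : Fin (1 + k) → ℝ | i ≠ j ∧ z (fc i) = z (fc j)}) ∪
      ⋃ i, ⋃ q ∈ S, {z : Fin (1 + k) → ℝ | z (fc i) = av q (z (bo k))} := by
    rintro z (⟨i, j, hij, h⟩ | ⟨i, q, hq, h⟩)
    · exact Or.inl (mem_iUnion.2 ⟨i, mem_iUnion.2 ⟨j, hij, h⟩⟩)
    · exact Or.inr (mem_iUnion.2 ⟨i, mem_iUnion.2 ⟨q, mem_iUnion.2 ⟨hq, h⟩⟩⟩)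
  refine measure_mono_null hsub (measure_union_null (measure_iUnion_null fun i =>
    measure_iUnion_null fun j => ?_) (measure_iUnion_null fun i => measure_iUnion_null fun q =>
    measure_iUnion_null fun _ => h2 i q))
  by_cases hij : i = j
  · simp [hij]
  · exact measure_mono_null (fun z hz => hz.2) (h1 i j hij)

/-! ### The fibre-mass theorem -/

/-- A nonzero real polynomial is bounded away from `0` on `[-L, L]` at distance `≥ 1/(n+1)` from
its roots. -/
theorem exists_pos_le_abs_eval (P : Polynomial ℝ) (hP : P ≠ 0) (L : ℝ) (n : ℕ) :
    ∃ δ > 0, ∀ y ∈ Icc (-L) L, (∀ r ∈ P.roots.toFinset, (1:ℝ) / (n + 1) ≤ |y - r|) → δ ≤ |P.eval y| := by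
  set K := Icc (-L) L ∩ {y : ℝ | ∀ r ∈ P.roots.toFinset, (1:ℝ) / (n + 1) ≤ |y - r|} with hK
  have hKc : IsCompact K := by
    refine isCompact_Icc.inter_right ?_
    have : {y : ℝ | ∀ r ∈ P.roots.toFinset, (1:ℝ) / (n + 1) ≤ |y - r|} =
        ⋂ r ∈ P.roots.toFinset, {y | (1:ℝ) / (n + 1) ≤ |y - r|} := by ext y; simp
    rw [this]
    exact isClosed_biInter fun r _ => isClosed_le continuous_const (continuous_id.sub continuous_const).abs
  by_cases hne : K.Nonempty
  · obtain ⟨y₀, hy₀, hmin⟩ := hKc.exists_isMinOn hne (P.continuous.abs.continuousOn)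
    refine ⟨|P.eval y₀|, ?_, fun y hy hy' => hmin (show y ∈ K from ⟨hy, hy'⟩)⟩
    refine abs_pos.2 fun h0 => ?_
    have hr : y₀ ∈ P.roots.toFinset := by
      rw [Multiset.mem_toFinset, Polynomial.mem_roots hP]; exact h0
    have := hy₀.2 y₀ hr
    simp only [sub_self, abs_zero] at this
    exact absurd this (not_le.2 (by positivity))
  · exact ⟨1, one_pos, fun y hy hy' => absurd ⟨y, hy, hy'⟩ hne⟩

/-- **Fibre-mass theorem.** For a bounded Janus band datum of base dimension one whose atoms lie
in `S`, if `P(y) · (letter block)` is absolutely integrable on the domain for some nonzero real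
polynomial `P`, then the letter block itself is absolutely integrable on the domain. -/
theorem integrableOn_LB (hYb : MeasurableSet Yb)
    (hlo : ∀ i c, lo i = Sum.inr c → c ∈ S) (hhi : ∀ i c, hi i = Sum.inr c → c ∈ S)
    (a : Fin k → Option Atom) (ha : ∀ i c, a i = some c → c ∈ S) {L : ℝ}
    (hL : ∀ z ∈ dom Yb lo hi, ∀ j, |z j| ≤ L) (P : Polynomial ℝ) (hP : P ≠ 0)
    (hint : IntegrableOn (fun z => P.eval (z (bo k)) * LB a z) (dom Yb lo hi)) :
    IntegrableOn (LB a) (dom Yb lo hi) := by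
  classical
  set D := dom Yb lo hi with hD
  have hDm : MeasurableSet D := measurableSet_dom hYb lo hi
  set Z := P.roots.toFinset with hZ
  set Kn : ℕ → Set ℝ := fun n => {y | ∀ r ∈ Z, (1:ℝ) / (n + 1) ≤ |y - r|} with hKn
  have hKnm : ∀ n, MeasurableSet (Kn n) := fun n => by
    have : Kn n = ⋂ r ∈ Z, {y | (1:ℝ) / (n + 1) ≤ |y - r|} := by ext y; simp [hKn]
    rw [this]
    exact MeasurableSet.biInter Z.countable_toSet fun r _ =>
      measurableSet_le measurable_const (measurable_id.sub_const r).abs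
  -- integrability away from the roots
  have hDK : ∀ n, IntegrableOn (LB a) (D ∩ {z | z (bo k) ∈ Kn n}) := by
    intro n
    obtain ⟨δ, hδ, hδle⟩ := exists_pos_le_abs_eval P hP L n
    have h1 : IntegrableOn (fun z => δ⁻¹ * ‖P.eval (z (bo k)) * LB a z‖) (D ∩ {z | z (bo k) ∈ Kn n}) :=
      ((hint.mono_set inter_subset_left).norm).const_mul _
    refine Integrable.mono' h1 (measurable_LB a).aestronglyMeasurable ?_
    filter_upwards [ae_restrict_mem (hDm.inter ((hKnm n).preimage (measurable_pi_apply _)))]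
      with z hz
    have hyL : |z (bo k)| ≤ L := hL z hz.1 _
    have hd := hδle (z (bo k)) (abs_le.1 hyL) hz.2
    rw [Real.norm_eq_abs, Real.norm_eq_abs, abs_mul, ← mul_assoc]
    calc |LB a z| = 1 * |LB a z| := (one_mul _).symm
      _ ≤ δ⁻¹ * |P.eval (z (bo k))| * |LB a z| := by
          refine mul_le_mul_of_nonneg_right ?_ (abs_nonneg _)
          rw [← div_le_iff₀' (inv_pos.2 hδ), one_div, inv_inv]; exact hd
  -- every piece
  have hpiece : ∀ π : Piece k S, IntegrableOn (LB a) (pset D S π) := by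
    intro π
    by_cases hgood : Good a π
    · exact integrableOn_LB_pset hYb lo hi a ha hL π hgood
    refine IntegrableOn.of_measure_zero ?_
    have hnull : ∀ n, volume (pset D S π ∩ {z | z (bo k) ∈ Kn n}) = 0 := fun n =>
      volume_pset_inter_eq_zero hYb hlo hhi a ha hL π hgood (hKnm n)
        ((hDK n).mono_set (inter_subset_inter_left _ (pset_subset _ _)))
    have hcov : pset D S π ⊆ (⋃ n, pset D S π ∩ {z | z (bo k) ∈ Kn n}) ∪
        {z | z (bo k) ∈ (Z : Set ℝ)} := by
      intro z hz
      by_cases hyZ : z (bo k) ∈ (Z : Set ℝ)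
      · exact Or.inr hyZ
      · left
        simp only [mem_iUnion]
        by_cases hZe : Z.Nonempty
        · obtain ⟨r₀, hr₀, hmin⟩ := Finset.exists_min_image Z (fun r => |z (bo k) - r|) hZe
          have hpos : 0 < |z (bo k) - r₀| := abs_pos.2 (sub_ne_zero.2 fun h => hyZ (h ▸ hr₀))
          obtain ⟨n, hn⟩ := exists_nat_one_div_lt hpos
          exact ⟨n, hz, fun r hr => (hn.le.trans (hmin r hr))⟩
        · refine ⟨0, hz, fun r hr => absurd ⟨r, hr⟩ hZe⟩
    refine measure_mono_null hcov (measure_union_null (measure_iUnion_null hnull) ?_)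
    exact volume_cylinder_eq_zero (bo k) Z.measurableSet (Z.finite_toSet.measure_zero _)
  -- covering of the domain by the pieces
  have hcover : D ⊆ (⋃ π : Piece k S, pset D S π) ∪ exc k S := by
    intro z hz
    by_cases hg : (∀ i j, i ≠ j → z (fc i) ≠ z (fc j)) ∧ (∀ i, ∀ q ∈ S, z (fc i) ≠ av q (z (bo k)))
    · obtain ⟨π, hπ⟩ := exists_piece Yb lo hi S hlo hhi hz hg.1 hg.2
      exact Or.inl (mem_iUnion.2 ⟨π, hπ⟩)
    · right
      simp only [not_and_or, not_forall, exists_prop, Decidable.not_not] at hg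
      rcases hg with ⟨i, j, hij, h⟩ | ⟨i, q, hq, h⟩
      · exact Or.inl ⟨i, j, hij, h⟩
      · exact Or.inr ⟨i, q, hq, h⟩
  exact ((integrableOn_finite_iUnion.2 hpiece).union
    (IntegrableOn.of_measure_zero (volume_exc k S))).mono_set hcover

end SepZero

/-- Registered support goal of this file: the fibre-mass theorem. -/
theorem separateZero_fibreMass (k : ℕ) (S : Finset SepZero.Atom) (Yb : Set ℝ) (hYb : MeasurableSet Yb) (lo hi : Fin k → Fin k ⊕ SepZero.Atom) (hlo : ∀ i c, lo i = Sum.inr c → c ∈ S) (hhi : ∀ i c, hi i = Sum.inr c → c ∈ S) (a : Fin k → Option SepZero.Atom) (ha : ∀ i c, a i = some c → c ∈ S) (L : ℝ) (hL : ∀ z ∈ SepZero.dom Yb lo hi, ∀ j, |z j| ≤ L) (P : Polynomial ℝ) (hP : P ≠ 0) (hint : MeasureTheory.IntegrableOn (fun z => P.eval (z (SepZero.bo k)) * SepZero.LB a z) (SepZero.dom Yb lo hi)) : MeasureTheory.IntegrableOn (SepZero.LB a) (SepZero.dom Yb lo hi) :=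
  SepZero.integrableOn_LB hYb hlo hhi a ha hL P hP hint

end Summit.KontsevichZagierPeriods.ArrangementNormalForm.JanusBands
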